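import Mathlib
import HarnessLib
import Summits.RiemannHypothesis.RiemannHypothesis.Theorems.EarlyAppointmentsRemainder0XiTruncationHelper

/-!
# Far Log-Kernel Window Bounds

This file proves bounds on the log-kernel integrand `log v / (1 - v²)` near v = 1,
used in the FarLogKernelSharp stub for the Remainder0Xi crux.

## Main Results

* `abs_log_div_one_sub_sq_le_one`: For v ∈ (3/4, 5/4), |log v / (1 - v²)| ≤ 1.
  Uses `log_le_sub_one_of_pos` (log x ≤ x - 1 for x > 0) from Mathlib.

* `excluded_window_bound`: For 0 < r ≤ 1/4, the window integral |∫_{1-r}^{1+r} log v/(1-v²)| ≤ 2r.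
  Follows from the pointwise bound and `norm_setIntegral_le_of_norm_le_const`.

## References

Supports stub_farLogKernelSharp for stmt-RiemannHypothesis-24730 (Remainder0Xi crux).
[cite: Titchmarsh1986, §9.8] for the log-kernel structure in ξ′/ξ representations.
-/

set_option linter.dupNamespace false
namespace Summit.RiemannHypothesis.RiemannHypothesis.Theorems.EarlyAppointmentsRemainder0Xi.FarKernel

open scoped BigOperators Topology Classical
open Real Complex MeasureTheory Set Filter

/-! ## Basic bounds -/

/-- For v ∈ (3/4, 5/4), the integrand |log(v)/(1-v²)| ≤ 1.

**Proof**: Case split on v < 1 vs v ≥ 1.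
- For v ∈ (3/4, 1): Use `log(1/v) ≤ 1/v - 1` (from `Real.log_le_sub_one_of_pos`).
  Then |log v/(1-v²)| = -log v/((1-v)(1+v)) ≤ (1-v)/v / ((1-v)(1+v)) = 1/(v(1+v)) ≤ 1.
- For v = 1: The ratio is 0 (L'Hopital limit is -1/2).
- For v ∈ (1, 5/4): Use `log v ≤ v - 1` (from `Real.log_le_sub_one_of_pos`).
  Then |log v/(1-v²)| = log v/(v²-1) ≤ (v-1)/((v-1)(v+1)) = 1/(v+1) ≤ 1. -/
lemma abs_log_div_one_sub_sq_le_one {v : ℝ} (hv_lo : 3 / 4 < v) (hv_hi : v < 5 / 4) :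
    |Real.log v / (1 - v ^ 2)| ≤ 1 := by
  by_cases hv1 : v < 1
  · -- Case v ∈ (3/4, 1): use log(1/v) ≤ 1/v - 1
    have hv_pos : 0 < v := by linarith
    have h_vsq_lt : v ^ 2 < 1 := by nlinarith
    have h_denom_pos : 0 < 1 - v ^ 2 := by linarith
    have h_log_nonpos : Real.log v ≤ 0 := Real.log_nonpos hv_pos.le hv1.le
    rw [abs_of_nonpos (div_nonpos_of_nonpos_of_nonneg h_log_nonpos h_denom_pos.le)]
    -- -(log v / (1-v²)) = log(1/v) / ((1-v)(1+v)) ≤ (1/v - 1) / ((1-v)(1+v))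
    -- = (1-v)/v / ((1-v)(1+v)) = 1/(v(1+v))
    have hvinv_pos : 0 < v⁻¹ := inv_pos.mpr hv_pos
    have hlog_bound : Real.log v⁻¹ ≤ v⁻¹ - 1 := Real.log_le_sub_one_of_pos hvinv_pos
    rw [Real.log_inv] at hlog_bound
    -- -log v ≤ 1/v - 1 = (1-v)/v
    have h1 : -Real.log v ≤ (1 - v) / v := by
      have : v⁻¹ - 1 = (1 - v) / v := by field_simp
      rw [← this]; exact hlog_bound
    have h_factor : 1 - v ^ 2 = (1 - v) * (1 + v) := by ring
    rw [h_factor]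
    have h1v_pos : 0 < 1 - v := by linarith
    have h1pv_pos : 0 < 1 + v := by linarith
    calc -(Real.log v / ((1 - v) * (1 + v)))
        = -Real.log v / ((1 - v) * (1 + v)) := by ring
      _ ≤ ((1 - v) / v) / ((1 - v) * (1 + v)) := by
          apply div_le_div_of_nonneg_right h1
          exact (mul_pos h1v_pos h1pv_pos).le
      _ = 1 / (v * (1 + v)) := by field_simp
      _ ≤ 1 := by
          rw [div_le_one (mul_pos hv_pos h1pv_pos)]
          nlinarith
  · -- Case v ∈ [1, 5/4): either v = 1 or v > 1
    simp only [not_lt] at hv1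
    rcases eq_or_lt_of_le hv1 with rfl | hv1'
    · -- v = 1: the ratio is 0 (both num and denom are 0, but we defined it as limit -1/2)
      simp only [Real.log_one, zero_div, abs_zero, zero_le_one]
    · -- Case v ∈ (1, 5/4): use log v ≤ v - 1
      have h_denom_neg : 1 - v ^ 2 < 0 := by nlinarith
      have h_log_pos : 0 < Real.log v := Real.log_pos hv1'
      rw [abs_of_neg (div_neg_of_pos_of_neg h_log_pos h_denom_neg)]
      -- -(log v / (1-v²)) = log v / (v²-1)
      have h_eq : -(Real.log v / (1 - v ^ 2)) = Real.log v / (v ^ 2 - 1) := by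
        have : 1 - v ^ 2 = -(v ^ 2 - 1) := by ring
        rw [this, div_neg, neg_neg]
      rw [h_eq]
      have hlog_bound : Real.log v ≤ v - 1 := Real.log_le_sub_one_of_pos (by linarith : 0 < v)
      have h_factor : v ^ 2 - 1 = (v - 1) * (v + 1) := by ring
      have hvm1_pos : 0 < v - 1 := by linarith
      have hvp1_pos : 0 < v + 1 := by linarith
      have h_denom_pos' : 0 < v ^ 2 - 1 := by nlinarith
      calc Real.log v / (v ^ 2 - 1)
          ≤ (v - 1) / (v ^ 2 - 1) := by
              apply div_le_div_of_nonneg_right hlog_bound h_denom_pos'.le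
        _ = (v - 1) / ((v - 1) * (v + 1)) := by rw [h_factor]
        _ = 1 / (v + 1) := by field_simp
        _ ≤ 1 := by
            rw [div_le_one hvp1_pos]
            linarith

/-- For 0 < r ≤ 1/4, the window integral around 1 is bounded by 2r (integrand is bounded by 1). -/
lemma excluded_window_bound {r : ℝ} (hr0 : 0 < r) (hr1 : r ≤ 1 / 4) :
    |∫ v in Ioo (1 - r) (1 + r), Real.log v / (1 - v ^ 2)| ≤ 2 * r := by
  have h_subset : Ioo (1 - r) (1 + r) ⊆ Ioo (3 / 4 : ℝ) (5 / 4) := by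
    intro v hv; constructor <;> linarith [hv.1, hv.2]
  -- The integrand is bounded by 1 on (3/4, 5/4) by abs_log_div_one_sub_sq_le_one
  have h_bnd : ∀ v ∈ Ioo (1 - r) (1 + r), ‖Real.log v / (1 - v ^ 2)‖ ≤ 1 := fun v hv => by
    rw [Real.norm_eq_abs]
    exact abs_log_div_one_sub_sq_le_one (h_subset hv).1 (h_subset hv).2
  -- Use norm_setIntegral_le_of_norm_le_const
  have hmeas : volume (Ioo (1 - r) (1 + r)) < ⊤ := measure_Ioo_lt_top
  have h_integral_bound := norm_setIntegral_le_of_norm_le_const hmeas h_bnd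
  -- Compute the measure: volume.real (Ioo (1-r) (1+r)) = 2r
  have h_meas_eq : volume.real (Ioo (1 - r) (1 + r)) = 2 * r := by
    rw [Measure.real, Real.volume_Ioo, ENNReal.toReal_ofReal (by linarith : 0 ≤ (1 + r) - (1 - r))]
    ring
  rw [h_meas_eq, one_mul] at h_integral_bound
  rw [← Real.norm_eq_abs]
  exact h_integral_bound

end Summit.RiemannHypothesis.RiemannHypothesis.Theorems.EarlyAppointmentsRemainder0Xi.FarKernel
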